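import Summits.ResolutionOfSingularities.ResolutionOfSingularities.Theses.FrobeniusClosing

/-!
# `ClosingReduction` — negative lemmas II: `MultP` is load-bearing, and dimension one is empty

Support (negative) lemmas for crux `stmt-ResolutionOfSingularities-16347`
(`Summit.ResolutionOfSingularities.ResolutionOfSingularities.Theses.FrobeniusClosing.ClosingReduction :=
NoPeriodicIsolatedAtom → BoundedMilnor → IsolatedForcedTermination`, route `FrobeniusClosing`), filed by
the standing disprover (cdisprove cycle 1; companion of `Negative/LoadBearing.lean`; work file
`Cruxes/ClosingReduction/Disproof.lean`). No definition is declared; every variant statement is the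
route's `let`-telescope verbatim with one predicate deleted or `n` specialised to `1`; no declaration
concludes a route decl positively.

* `isolatedForcedTermination_false_without_MultP` — the crux's conclusion with the multiplicity
  predicate `MultP` deleted is FALSE (trivially): the smooth germ `a = u₀` (`n = 1`, `p = 2`, `𝔽₂`)
  has Milnor algebra `0` and, its cleaned order being `1 < p`, is fixed by every step
  (`smoothGerm_run_isol`).
* `isolatedForcedTermination_dim_one` — DIMENSION ONE IS EMPTY: the conclusion HOLDS for `n = 1` over
  every field (the `n = 1` instance of the body of `IsolatedForcedTermination`, by `intro`/`exact`):
  along a multiplicity-`p` run the cleaned order drops by exactly `p` at every step (the blow-up chart and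
  the Taylor shift are the identity on coefficients when `n = 1`: `blowupChart_fin_one`,
  `taylorShift_fin_one`), so no run of length `> ord(a₀)/p` has all states of multiplicity `p`. A
  counterexample to the crux therefore needs `n ≥ 2` (and `n = 2` is excluded on paper by
  Zariski–Lipman: an isolated hypersurface point of a surface is normal, and chains of "blow up a singular
  point of a normal excellent surface (+ normalise)" terminate — not formalised here).

## Sources
* J. Lipman, *Desingularization of two-dimensional schemes*, Ann. of Math. 107 (1978) 151–207.
* H. Hauser, S. Perlega, arXiv:1802.05010, §1.
-/

noncomputable section

set_option linter.dupNamespace false -- mandated namespace of this single-conjunct summit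

open Summit.ResolutionOfSingularities.ResolutionOfSingularities.Theses.FrobeniusClosing

namespace Summit.ResolutionOfSingularities.ResolutionOfSingularities.Theorems.ClosingReduction.Negative

/-! ## The `n = 1` collapse of the coefficient calculus -/

/-- **The blow-up chart is the identity on coefficients when `n = 1`** (`Σ_{j ≠ i} B j = 0`).
[folklore] -/
theorem blowupChart_fin_one (κ : Type) [Field κ] (i : Fin 1) (c : (Fin 1 → ℕ) → κ) (B : Fin 1 → ℕ) :
    @ite κ (Finset.sum (Finset.univ.erase i) (fun j => B j) ≤ B i) (Classical.dec _)
      (c (Function.update B i (B i - Finset.sum (Finset.univ.erase i) (fun j => B j)))) 0 = c B := by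
  have he : (Finset.univ : Finset (Fin 1)).erase i = ∅ := by
    ext j; simp [Subsingleton.elim j i]
  have hs : Finset.sum (Finset.univ.erase i) (fun j => B j) = 0 := by
    rw [he, Finset.sum_empty]
  rw [hs]
  simp

/-- **The Taylor shift is the identity when `n = 1`** (nothing to translate: `D i = 0` forces `D = 0`).
[folklore] -/
theorem taylorShift_fin_one (κ : Type) [Field κ] (i : Fin 1) (τ : Fin 1 → κ) (s : ℕ)
    (c : (Fin 1 → ℕ) → κ) (B : Fin 1 → ℕ) :
    Finset.sum (Fintype.piFinset (fun _ : Fin 1 => Finset.range (B i + s + 1)))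
      (fun D => @ite κ (D i = 0) (Classical.dec _) (c (B + D) * Finset.prod (Finset.univ.erase i)
        (fun j => ((Nat.choose (B j + D j) (B j) : ℕ) : κ) * τ j ^ (D j))) 0) = c B := by
  have he : (Finset.univ : Finset (Fin 1)).erase i = ∅ := by
    ext j; simp [Subsingleton.elim j i]
  rw [Finset.sum_eq_single (0 : Fin 1 → ℕ)]
  · rw [if_pos (show (0 : Fin 1 → ℕ) i = 0 from rfl), he, Finset.prod_empty, mul_one, add_zero]
  · intro D _ hD0
    have hDi : D i ≠ 0 := by
      intro h
      apply hD0
      funext j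
      rw [Subsingleton.elim j i, h]
      rfl
    rw [if_neg hDi]
  · intro h0
    exfalso
    apply h0
    simp [Fintype.mem_piFinset]

/-! ## The smooth germ `a = u₀` (`n = 1`): `MultP` is load-bearing -/

/-- The run of the smooth germ `a = u₀` (`p = 2`, `n = 1`, `κ = 𝔽₂`) is constant — its cleaned order is
`1 < 2`, so no division happens, and chart/shift are the identity for `n = 1` — and every state is
"isolated" (`∂u₀/∂u₀ = 1`, Milnor algebra `0`). [folklore] -/
theorem smoothGerm_run_isol :
    let clean : ((Fin 1 → ℕ) → (ZMod 2)) → ((Fin 1 → ℕ) → (ZMod 2)) := fun c A => @ite (ZMod 2) (∀ j, 2 ∣ A j) (Classical.dec _) 0 (c A);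
    let bl : Fin 1 → ((Fin 1 → ℕ) → (ZMod 2)) → ((Fin 1 → ℕ) → (ZMod 2)) := fun i c B => @ite (ZMod 2) (Finset.sum (Finset.univ.erase i) (fun j => B j) ≤ B i) (Classical.dec _) (c (Function.update B i (B i - Finset.sum (Finset.univ.erase i) (fun j => B j)))) 0;
    let ord : ((Fin 1 → ℕ) → (ZMod 2)) → ℕ := fun c => sInf {m : ℕ | ∃ A, c A ≠ 0 ∧ m = Finset.sum Finset.univ (fun j => A j)};
    let dv : Fin 1 → ℕ → ((Fin 1 → ℕ) → (ZMod 2)) → ((Fin 1 → ℕ) → (ZMod 2)) := fun i s c B => c (Function.update B i (B i + s));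
    let tr : Fin 1 → (Fin 1 → (ZMod 2)) → ℕ → ((Fin 1 → ℕ) → (ZMod 2)) → ((Fin 1 → ℕ) → (ZMod 2)) := fun i τ s c B => Finset.sum (Fintype.piFinset (fun _ : Fin 1 => Finset.range (B i + s + 1))) (fun D => @ite (ZMod 2) (D i = 0) (Classical.dec _) (c (B + D) * Finset.prod (Finset.univ.erase i) (fun j => ((Nat.choose (B j + D j) (B j) : ℕ) : (ZMod 2)) * τ j ^ (D j))) 0);
    let step : Fin 1 → (Fin 1 → (ZMod 2)) → ((Fin 1 → ℕ) → (ZMod 2)) → ((Fin 1 → ℕ) → (ZMod 2)) := fun i τ c => clean (tr i τ (@ite ℕ (2 ≤ ord (clean c)) (Classical.dec _) 2 0) (dv i (@ite ℕ (2 ≤ ord (clean c)) (Classical.dec _) 2 0) (bl i (clean c))));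
    let run : ((Fin 1 → ℕ) → (ZMod 2)) → (ℕ → Fin 1) → (ℕ → Fin 1 → (ZMod 2)) → ℕ → ((Fin 1 → ℕ) → (ZMod 2)) := fun c₀ i t m => @Nat.rec (fun _ => (Fin 1 → ℕ) → (ZMod 2)) c₀ (fun m c => step (i m) (t m) c) m;
    let ser : ((Fin 1 → ℕ) → (ZMod 2)) → MvPowerSeries (Fin 1) (ZMod 2) := fun c => show MvPowerSeries (Fin 1) (ZMod 2) from fun A : Fin 1 →₀ ℕ => clean c ⇑A;
    let pd : Fin 1 → MvPowerSeries (Fin 1) (ZMod 2) → MvPowerSeries (Fin 1) (ZMod 2) := fun i f => show MvPowerSeries (Fin 1) (ZMod 2) from fun A : Fin 1 →₀ ℕ => ((A i + 1 : ℕ) : (ZMod 2)) * f (A + Finsupp.single i 1);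
    let jac : ((Fin 1 → ℕ) → (ZMod 2)) → Ideal (MvPowerSeries (Fin 1) (ZMod 2)) := fun c => Ideal.span (Set.range (fun i => pd i (ser c)));
    let Isol : ((Fin 1 → ℕ) → (ZMod 2)) → Prop := fun c => Module.Finite (ZMod 2) (MvPowerSeries (Fin 1) (ZMod 2) ⧸ jac c);
    ∀ m, Isol (run (fun A : Fin 1 → ℕ => if A 0 = 1 then (1 : ZMod 2) else 0) (fun _ : ℕ => (0 : Fin 1)) (fun (_ : ℕ) (_ : Fin 1) => (0 : ZMod 2)) m) := by
  intro clean bl ord dv tr step run ser pd jac Isol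
  set lin : (Fin 1 → ℕ) → ZMod 2 := (fun A : Fin 1 → ℕ => if A 0 = 1 then (1 : ZMod 2) else 0) with hlin
  have hcl : clean lin = lin := by
    funext A
    show @ite (ZMod 2) (∀ j, 2 ∣ A j) (Classical.dec _) 0 (lin A) = lin A
    rw [hlin]
    dsimp only
    split_ifs with h1 h2
    · exact absurd (h2 ▸ h1 0) (by norm_num)
    · rfl
    · rfl
    · rfl
  have hord : ord lin = 1 := by
    show sInf {m : ℕ | ∃ A, lin A ≠ 0 ∧ m = Finset.sum Finset.univ (fun j => A j)} = 1
    have : {m : ℕ | ∃ A, lin A ≠ 0 ∧ m = Finset.sum Finset.univ (fun j => A j)} = {1} := by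
      ext m
      rw [hlin]
      simp only [Set.mem_setOf_eq, Set.mem_singleton_iff, ne_eq, ite_eq_right_iff,
        one_ne_zero, imp_false, not_not, Fin.sum_univ_one]
      constructor
      · rintro ⟨A, hA, rfl⟩; exact hA
      · intro hm; exact ⟨fun _ => 1, rfl, hm⟩
    rw [this, csInf_singleton]
  have hbl : ∀ (j : Fin 1) (c : (Fin 1 → ℕ) → ZMod 2), bl j c = c := fun j c =>
    funext fun B => blowupChart_fin_one (ZMod 2) j c B
  have htr : ∀ (j : Fin 1) (τ : Fin 1 → ZMod 2) (s : ℕ) (c : (Fin 1 → ℕ) → ZMod 2), tr j τ s c = c :=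
    fun j τ s c => funext fun B => taylorShift_fin_one (ZMod 2) j τ s c B
  have htr0 : ∀ Y : (Fin 1 → ℕ) → ZMod 2, tr 0 (fun _ => 0) 0 Y = Y := fun Y => htr 0 _ 0 Y
  have hbl0 : ∀ Y : (Fin 1 → ℕ) → ZMod 2, bl 0 Y = Y := fun Y => hbl 0 Y
  have hstep : step 0 (fun _ => 0) lin = lin := by
    show clean (tr 0 (fun _ => 0) (@ite ℕ (2 ≤ ord (clean lin)) (Classical.dec _) 2 0)
      (dv 0 (@ite ℕ (2 ≤ ord (clean lin)) (Classical.dec _) 2 0) (bl 0 (clean lin)))) = lin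
    rw [hcl, hord, if_neg (by norm_num), htr0, hbl0]
    have hdv : dv 0 0 lin = lin := funext fun B => by
      show lin (Function.update B 0 (B 0 + 0)) = lin B
      simp
    rw [hdv, hcl]
  have hrun : ∀ m, run lin (fun _ : ℕ => (0 : Fin 1)) (fun (_ : ℕ) (_ : Fin 1) => (0 : ZMod 2)) m = lin := by
    intro m
    induction m with
    | zero => rfl
    | succ m ih =>
      show step 0 (fun _ => 0) (run lin (fun _ : ℕ => (0 : Fin 1)) (fun (_ : ℕ) (_ : Fin 1) => (0 : ZMod 2)) m) = lin
      rw [ih]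
      exact hstep
  have hpd : pd 0 (ser lin) = 1 := by
    ext A
    show ((A 0 + 1 : ℕ) : ZMod 2) * clean lin ⇑(A + Finsupp.single (0 : Fin 1) (1 : ℕ)) =
      MvPowerSeries.coeff A 1
    rw [hcl, MvPowerSeries.coeff_one, hlin]
    simp only [Finsupp.coe_add, Pi.add_apply, Finsupp.single_eq_same]
    by_cases hA : A = 0
    · subst hA; simp
    · have hA0 : A 0 ≠ 0 := by
        intro h; apply hA; refine Finsupp.ext fun j => ?_; rw [Subsingleton.elim j 0, h]; rfl
      rw [if_neg (by omega), if_neg hA, mul_zero]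
  have hisol : Isol lin := by
    show Module.Finite (ZMod 2) (MvPowerSeries (Fin 1) (ZMod 2) ⧸ jac lin)
    have htop : jac lin = ⊤ := by
      show Ideal.span (Set.range (fun i => pd i (ser lin))) = ⊤
      rw [Ideal.eq_top_iff_one]
      exact Ideal.subset_span ⟨0, hpd⟩
    rw [htop]
    haveI : Subsingleton (MvPowerSeries (Fin 1) (ZMod 2) ⧸ (⊤ : Ideal (MvPowerSeries (Fin 1) (ZMod 2)))) :=
      Ideal.Quotient.subsingleton_iff.2 rfl
    infer_instance
  intro m
  rw [hrun m]
  exact hisol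

/-- **`MultP` is load-bearing in the conclusion (trivially).** `IsolatedForcedTermination` with the
multiplicity predicate `MultP` deleted (verbatim otherwise) is FALSE: witness `p = 2`, `n = 1`,
`κ = 𝔽₂`, the smooth germ `a = u₀` (`smoothGerm_run_isol`). [folklore] -/
theorem isolatedForcedTermination_false_without_MultP :
    ¬ (∀ p : ℕ, p.Prime → ∀ n : ℕ, 0 < n → ∀ (κ : Type) [Field κ] [CharP κ p] [PerfectField κ]
      (c₀ : (Fin n → ℕ) → κ) (i : ℕ → Fin n) (t : ℕ → Fin n → κ),
    let clean : ((Fin n → ℕ) → κ) → ((Fin n → ℕ) → κ) := fun c A => @ite κ (∀ j, p ∣ A j) (Classical.dec _) 0 (c A);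
    let bl : Fin n → ((Fin n → ℕ) → κ) → ((Fin n → ℕ) → κ) := fun i c B => @ite κ (Finset.sum (Finset.univ.erase i) (fun j => B j) ≤ B i) (Classical.dec _) (c (Function.update B i (B i - Finset.sum (Finset.univ.erase i) (fun j => B j)))) 0;
    let ord : ((Fin n → ℕ) → κ) → ℕ := fun c => sInf {m : ℕ | ∃ A, c A ≠ 0 ∧ m = Finset.sum Finset.univ (fun j => A j)};
    let dv : Fin n → ℕ → ((Fin n → ℕ) → κ) → ((Fin n → ℕ) → κ) := fun i s c B => c (Function.update B i (B i + s));
    let tr : Fin n → (Fin n → κ) → ℕ → ((Fin n → ℕ) → κ) → ((Fin n → ℕ) → κ) := fun i τ s c B => Finset.sum (Fintype.piFinset (fun _ : Fin n => Finset.range (B i + s + 1))) (fun D => @ite κ (D i = 0) (Classical.dec _) (c (B + D) * Finset.prod (Finset.univ.erase i) (fun j => ((Nat.choose (B j + D j) (B j) : ℕ) : κ) * τ j ^ (D j))) 0);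
    let step : Fin n → (Fin n → κ) → ((Fin n → ℕ) → κ) → ((Fin n → ℕ) → κ) := fun i τ c => clean (tr i τ (@ite ℕ (p ≤ ord (clean c)) (Classical.dec _) p 0) (dv i (@ite ℕ (p ≤ ord (clean c)) (Classical.dec _) p 0) (bl i (clean c))));
    let run : ((Fin n → ℕ) → κ) → (ℕ → Fin n) → (ℕ → Fin n → κ) → ℕ → ((Fin n → ℕ) → κ) := fun c₀ i t m => @Nat.rec (fun _ => (Fin n → ℕ) → κ) c₀ (fun m c => step (i m) (t m) c) m;
    let ser : ((Fin n → ℕ) → κ) → MvPowerSeries (Fin n) κ := fun c => show MvPowerSeries (Fin n) κ from fun A : Fin n →₀ ℕ => clean c ⇑A;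
    let pd : Fin n → MvPowerSeries (Fin n) κ → MvPowerSeries (Fin n) κ := fun i f => show MvPowerSeries (Fin n) κ from fun A : Fin n →₀ ℕ => ((A i + 1 : ℕ) : κ) * f (A + Finsupp.single i 1);
    let jac : ((Fin n → ℕ) → κ) → Ideal (MvPowerSeries (Fin n) κ) := fun c => Ideal.span (Set.range (fun i => pd i (ser c)));
    let Isol : ((Fin n → ℕ) → κ) → Prop := fun c => Module.Finite κ (MvPowerSeries (Fin n) κ ⧸ jac c);
    ¬ (∀ m, Isol (run c₀ i t m))) := by
  intro h
  exact h 2 Nat.prime_two 1 one_pos (ZMod 2) (fun A : Fin 1 → ℕ => if A 0 = 1 then (1 : ZMod 2) else 0) (fun _ : ℕ => (0 : Fin 1)) (fun (_ : ℕ) (_ : Fin 1) => (0 : ZMod 2)) smoothGerm_run_isol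

/-! ## Dimension one is empty: the conclusion holds for `n = 1` -/

/-- **No counterexample lives in dimension `n = 1`: the body of `IsolatedForcedTermination` HOLDS at
`n = 1`** (its `n = 1` instance follows by `intro`/`exact`; neither perfectness nor the characteristic
is used). Along a multiplicity-`p` run, if the cleaned order of the `m`-th state is `d` (attained at the
exponent `d`, `p ∤ d`, `d ≥ p`), the next state has the non-zero cleaned coefficient at `d - p`; so the
potential `ord` drops by `≥ p` per step while staying `≥ p` — impossible beyond `ord(a₀)/p` steps.
[folklore] -/
theorem isolatedForcedTermination_dim_one :
    ∀ p : ℕ, p.Prime → ∀ (κ : Type) [Field κ] [CharP κ p] [PerfectField κ]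
      (c₀ : (Fin 1 → ℕ) → κ) (i : ℕ → Fin 1) (t : ℕ → Fin 1 → κ),
    let clean : ((Fin 1 → ℕ) → κ) → ((Fin 1 → ℕ) → κ) := fun c A => @ite κ (∀ j, p ∣ A j) (Classical.dec _) 0 (c A);
    let bl : Fin 1 → ((Fin 1 → ℕ) → κ) → ((Fin 1 → ℕ) → κ) := fun i c B => @ite κ (Finset.sum (Finset.univ.erase i) (fun j => B j) ≤ B i) (Classical.dec _) (c (Function.update B i (B i - Finset.sum (Finset.univ.erase i) (fun j => B j)))) 0;
    let ord : ((Fin 1 → ℕ) → κ) → ℕ := fun c => sInf {m : ℕ | ∃ A, c A ≠ 0 ∧ m = Finset.sum Finset.univ (fun j => A j)};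
    let dv : Fin 1 → ℕ → ((Fin 1 → ℕ) → κ) → ((Fin 1 → ℕ) → κ) := fun i s c B => c (Function.update B i (B i + s));
    let tr : Fin 1 → (Fin 1 → κ) → ℕ → ((Fin 1 → ℕ) → κ) → ((Fin 1 → ℕ) → κ) := fun i τ s c B => Finset.sum (Fintype.piFinset (fun _ : Fin 1 => Finset.range (B i + s + 1))) (fun D => @ite κ (D i = 0) (Classical.dec _) (c (B + D) * Finset.prod (Finset.univ.erase i) (fun j => ((Nat.choose (B j + D j) (B j) : ℕ) : κ) * τ j ^ (D j))) 0);
    let step : Fin 1 → (Fin 1 → κ) → ((Fin 1 → ℕ) → κ) → ((Fin 1 → ℕ) → κ) := fun i τ c => clean (tr i τ (@ite ℕ (p ≤ ord (clean c)) (Classical.dec _) p 0) (dv i (@ite ℕ (p ≤ ord (clean c)) (Classical.dec _) p 0) (bl i (clean c))));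
    let run : ((Fin 1 → ℕ) → κ) → (ℕ → Fin 1) → (ℕ → Fin 1 → κ) → ℕ → ((Fin 1 → ℕ) → κ) := fun c₀ i t m => @Nat.rec (fun _ => (Fin 1 → ℕ) → κ) c₀ (fun m c => step (i m) (t m) c) m;
    let ser : ((Fin 1 → ℕ) → κ) → MvPowerSeries (Fin 1) κ := fun c => show MvPowerSeries (Fin 1) κ from fun A : Fin 1 →₀ ℕ => clean c ⇑A;
    let pd : Fin 1 → MvPowerSeries (Fin 1) κ → MvPowerSeries (Fin 1) κ := fun i f => show MvPowerSeries (Fin 1) κ from fun A : Fin 1 →₀ ℕ => ((A i + 1 : ℕ) : κ) * f (A + Finsupp.single i 1);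
    let jac : ((Fin 1 → ℕ) → κ) → Ideal (MvPowerSeries (Fin 1) κ) := fun c => Ideal.span (Set.range (fun i => pd i (ser c)));
    let Isol : ((Fin 1 → ℕ) → κ) → Prop := fun c => Module.Finite κ (MvPowerSeries (Fin 1) κ ⧸ jac c);
    let MultP : ((Fin 1 → ℕ) → κ) → Prop := fun c => (∃ A, clean c A ≠ 0) ∧ ∀ A, clean c A ≠ 0 → p ≤ Finset.sum Finset.univ (fun j => A j);
    ¬ (∀ m, Isol (run c₀ i t m) ∧ MultP (run c₀ i t m)) := by
  intro p hp κ _ _ _ c₀ i t clean bl ord dv tr step run ser pd jac Isol MultP h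
  have hM : ∀ m, MultP (run c₀ i t m) := fun m => (h m).2
  -- unfolding equations of the local `let`s
  have hclean : ∀ (c : (Fin 1 → ℕ) → κ) (A : Fin 1 → ℕ),
      clean c A = @ite κ (∀ j, p ∣ A j) (Classical.dec _) 0 (c A) := fun _ _ => rfl
  have hord : ∀ c : (Fin 1 → ℕ) → κ,
      ord c = sInf {m : ℕ | ∃ A, c A ≠ 0 ∧ m = Finset.sum Finset.univ (fun j => A j)} := fun _ => rfl
  have hmultP : ∀ c : (Fin 1 → ℕ) → κ, MultP c ↔
      (∃ A, clean c A ≠ 0) ∧ ∀ A, clean c A ≠ 0 → p ≤ Finset.sum Finset.univ (fun j => A j) :=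
    fun _ => Iff.rfl
  have hbl : ∀ (j : Fin 1) (c : (Fin 1 → ℕ) → κ), bl j c = c := fun j c =>
    funext fun B => blowupChart_fin_one κ j c B
  have htr : ∀ (j : Fin 1) (τ : Fin 1 → κ) (s : ℕ) (c : (Fin 1 → ℕ) → κ), tr j τ s c = c :=
    fun j τ s c => funext fun B => taylorShift_fin_one κ j τ s c B
  have hstep : ∀ (j : Fin 1) (τ : Fin 1 → κ) (c : (Fin 1 → ℕ) → κ), step j τ c =
      clean (fun B => clean c (Function.update B j
        (B j + @ite ℕ (p ≤ ord (clean c)) (Classical.dec _) p 0))) := by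
    intro j τ c
    show clean (tr j τ (@ite ℕ (p ≤ ord (clean c)) (Classical.dec _) p 0)
      (dv j (@ite ℕ (p ≤ ord (clean c)) (Classical.dec _) p 0) (bl j (clean c)))) = _
    rw [htr, hbl]
  have hrun : ∀ m, run c₀ i t (m + 1) = step (i m) (t m) (run c₀ i t m) := fun _ => rfl
  have hcc : ∀ c : (Fin 1 → ℕ) → κ, clean (clean c) = clean c := by
    intro c; funext A; rw [hclean, hclean]; split_ifs <;> rfl
  -- order bookkeeping
  have hle_ord : ∀ m, p ≤ ord (clean (run c₀ i t m)) := by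
    intro m
    obtain ⟨⟨A₀, hA₀⟩, hmin⟩ := (hmultP _).1 (hM m)
    rw [hord]
    obtain ⟨A, hA, hm⟩ := Nat.sInf_mem (s := {d : ℕ | ∃ A, clean (run c₀ i t m) A ≠ 0 ∧
      d = Finset.sum Finset.univ (fun j => A j)}) ⟨_, A₀, hA₀, rfl⟩
    rw [hm]
    exact hmin A hA
  set N : ℕ → ℕ := fun m => ord (clean (run c₀ i t m)) with hN
  have hdrop : ∀ m, N (m + 1) + p ≤ N m := by
    intro m
    obtain ⟨⟨A₀, hA₀⟩, hmin⟩ := (hmultP _).1 (hM m)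
    obtain ⟨A, hA, hordA⟩ := Nat.sInf_mem (s := {d : ℕ | ∃ A, clean (run c₀ i t m) A ≠ 0 ∧
      d = Finset.sum Finset.univ (fun j => A j)}) ⟨_, A₀, hA₀, rfl⟩
    have hpA : p ≤ Finset.sum Finset.univ (fun j => A j) := hmin A hA
    have hsumA : Finset.sum Finset.univ (fun j => A j) = A (i m) := by
      rw [Fintype.sum_eq_single (i m) (fun j hj => (hj (Subsingleton.elim j (i m))).elim)]
    have hndvd : ¬ ∀ j, p ∣ A j := by
      intro hd
      apply hA
      rw [hclean, if_pos hd]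
    set B : Fin 1 → ℕ := fun _ => A (i m) - p with hB
    have h2 : p ≤ A (i m) := hsumA ▸ hpA
    have hBupd : Function.update B (i m) (B (i m) + p) = A := by
      funext j
      rw [Subsingleton.elim j (i m), Function.update_self, hB]
      show A (i m) - p + p = A (i m)
      omega
    have hBndvd : ¬ ∀ j, p ∣ B j := by
      intro hd
      apply hndvd
      intro j
      rw [Subsingleton.elim j (i m)]
      have h1 : p ∣ A (i m) - p := by simpa [hB] using hd (i m)
      have : A (i m) = (A (i m) - p) + p := by omega
      rw [this]
      exact dvd_add h1 (dvd_refl p)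
    have hnext : clean (run c₀ i t (m + 1)) B ≠ 0 := by
      rw [hrun, hstep, hcc]
      show @ite κ (∀ j, p ∣ B j) (Classical.dec _) 0 (clean (run c₀ i t m)
        (Function.update B (i m) (B (i m) +
          @ite ℕ (p ≤ ord (clean (run c₀ i t m))) (Classical.dec _) p 0))) ≠ 0
      rw [if_neg hBndvd, if_pos (hle_ord m), hBupd]
      exact hA
    have hle : N (m + 1) ≤ Finset.sum Finset.univ (fun j => B j) := by
      show ord (clean (run c₀ i t (m + 1))) ≤ _
      rw [hord]
      exact Nat.sInf_le ⟨B, hnext, rfl⟩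
    have hsumB : Finset.sum Finset.univ (fun j => B j) = A (i m) - p := by
      rw [Fintype.sum_eq_single (i m) (fun j hj => (hj (Subsingleton.elim j (i m))).elim)]
    have hNm : N m = A (i m) := by
      show ord (clean (run c₀ i t m)) = _
      rw [hord]
      exact hordA.trans hsumA
    omega
  have hbound : ∀ m, N m + m * p ≤ N 0 := by
    intro m
    induction m with
    | zero => simp
    | succ m ih =>
      have := hdrop m
      rw [Nat.succ_mul]
      omega
  have h1 := hbound (N 0)
  have h2 := hle_ord (N 0)
  have h3 := hle_ord 0
  have hp2 : 2 ≤ p := hp.two_le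
  change p ≤ N (N 0) at h2
  change p ≤ N 0 at h3
  nlinarith

end Summit.ResolutionOfSingularities.ResolutionOfSingularities.Theorems.ClosingReduction.Negative

end
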